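import Summits.Ventures.PercRepro.RankLevelSetMinorPairNormSkew

/-! # RankLevelSetBiIndepMonoSum — MONO (THE MONOTONE FORM OF THE BI-INDEPENDENT PROFILE, C-025's RESIDUE) IS
CLOSED UNDER DIRECT SUMS AND UNDER TRUNCATION; HENCE IT HOLDS ON THE SUM-AND-TRUNCATION CLOSURE OF THE PAVING
MATROIDS (night-1 g31; dossier §43.5)

`BiIndepMono M` («Mono»: `(#E − j)·D_j ≤ (j + 1)·D_{j+1}` for `2j + 1 < #E`, the normalized bi-independent profile
`D_j / C(#E, j)` nondecreasing up to the middle) is, by the symmetry `D_j = D_{#E − j}`, exactly the normalized skew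
`SkewConv.NormSkew (biIndepCount M) #E` of the profile (**`normSkew_biIndepCount_of_mono`**,
**`biIndepMono_of_normSkew`**). The profile of a direct sum is the convolution of the profiles and the normalized
skew is additive under convolution (`SkewConv.normSkew_conv`), so **`biIndepMono_disjointSum : BiIndepMono M →`
`BiIndepMono N → BiIndepMono (M ⊕ N)`**: a counterexample to Mono, if any, can be taken CONNECTED. The profile of a
truncation is a window of the profile symmetric about `#E/2`, so **`biIndepMono_truncateTo`**: Mono survives every
truncation. With `biIndepMono_of_paving` (g25): Mono holds on every matroid built from paving matroids by direct
sums and truncations (`biIndepMono_of_normHalf` gives it from NHR as well). Every declaration has a docstring;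
imports: the cell's own modules and Mathlib only. Axioms: standard. -/

namespace PercRepro

open Set Matroid

variable {α : Type} (M : Matroid α) [M.Finite]

/-- **Mono is the normalized skew of the bi-independent profile with parameter `#E`**: `BiIndepMono M →`
`NormSkew (biIndepCount M) #E` (g24's `biIndepNorm_ge_of_mono`: `d_q ≤ d_t` for `q ≤ t ≤ #E − q`). -/
theorem normSkew_biIndepCount_of_mono (h : BiIndepMono M) : SkewConv.NormSkew (biIndepCount M) M.E.ncard := by
  intro i j hij hR
  have hq := biIndepNorm_ge_of_mono M h hij.le (by omega)
  unfold biIndepNorm at hq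
  have hCi : (0 : ℚ) < (M.E.ncard.choose i : ℚ) := by exact_mod_cast Nat.choose_pos (by omega)
  have hCj : (0 : ℚ) < (M.E.ncard.choose j : ℚ) := by exact_mod_cast Nat.choose_pos (by omega)
  rw [div_le_div_iff₀ hCi hCj] at hq
  exact_mod_cast hq

omit [M.Finite] in
/-- **The normalized skew of the bi-independent profile with parameter `#E` is Mono**: the consecutive
comparisons `(j, j + 1)` with `2j + 1 < #E`. -/
theorem biIndepMono_of_normSkew (h : SkewConv.NormSkew (biIndepCount M) M.E.ncard) : BiIndepMono M := by
  intro j hj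
  have h1 := h j (j + 1) (by omega) (by omega)
  rw [← biIndepNorm_le_succ_iff M j (by omega)]
  unfold biIndepNorm
  have hCj : (0 : ℚ) < (M.E.ncard.choose j : ℚ) := by exact_mod_cast Nat.choose_pos (by omega)
  have hCj1 : (0 : ℚ) < (M.E.ncard.choose (j + 1) : ℚ) := by exact_mod_cast Nat.choose_pos (by omega)
  rw [div_le_div_iff₀ hCj hCj1]
  exact_mod_cast h1

/-- The bi-independent profile is the `(∅, ∅)` mixed profile of g29. -/
lemma biIndepCount_eq_minorPairCount_empty (k : ℕ) : biIndepCount M k = minorPairCount M ∅ ∅ k := by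
  rw [← biContainCount_empty M k, biContainCount_eq_minorPairCount M (Set.empty_subset _) (k := k) (by simp)]
  simp

/-- Mono is the normalized skew of the `(∅, ∅)` mixed profile. -/
theorem minorPairNormSkew_empty_of_mono (h : BiIndepMono M) : MinorPairNormSkew M ∅ ∅ M.E.ncard :=
  SkewConv.normSkew_congr (normSkew_biIndepCount_of_mono M h) fun k _ => biIndepCount_eq_minorPairCount_empty M k

/-- **NHR on the empty contain-set is Mono.** -/
theorem biIndepMono_of_normHalf (h : BiContainNormHalf M) : BiIndepMono M := by
  apply biIndepMono_of_normSkew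
  have h0 := h ∅ (Set.empty_subset _)
  simp only [Set.ncard_empty, Nat.mul_zero, Nat.sub_zero] at h0
  exact SkewConv.normSkew_congr h0 fun k _ => (biIndepCount_eq_minorPairCount_empty M k).symm

section Sum

variable {M} {N : Matroid α} [N.Finite] {h : Disjoint M.E N.E}

/-- **MONO IS CLOSED UNDER DIRECT SUMS**: `BiIndepMono M → BiIndepMono N → BiIndepMono (M ⊕ N)`. -/
theorem biIndepMono_disjointSum (hM : BiIndepMono M) (hN : BiIndepMono N) :
    haveI : (M.disjointSum N h).Finite := ⟨by
      rw [Matroid.disjointSum_ground_eq]; exact M.ground_finite.union N.ground_finite⟩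
    BiIndepMono (M.disjointSum N h) := by
  haveI : (M.disjointSum N h).Finite := ⟨by
    rw [Matroid.disjointSum_ground_eq]; exact M.ground_finite.union N.ground_finite⟩
  apply biIndepMono_of_normSkew
  have key := minorPairNormSkew_disjointSum (h := h) (Set.empty_subset M.E) (Set.empty_subset M.E)
    (Set.empty_subset N.E) (Set.empty_subset N.E) (Set.disjoint_empty _) (Set.disjoint_empty _)
    (minorPairNormSkew_empty_of_mono M hM) (minorPairNormSkew_empty_of_mono N hN)
  rw [Set.union_empty] at key
  unfold MinorPairNormSkew at key
  rw [ncard_ground_disjointSum]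
  exact SkewConv.normSkew_congr key fun k _ => (biIndepCount_eq_minorPairCount_empty _ k).symm

end Sum

/-- **MONO SURVIVES TRUNCATION**: `BiIndepMono M → BiIndepMono (T_k M)` (the profile of `T_k M` is the window
`#E − k ≤ level ≤ k` of the profile of `M`, symmetric about `#E/2`). -/
theorem biIndepMono_truncateTo (h : BiIndepMono M) (k : ℕ) :
    haveI := truncateTo_finite M k
    BiIndepMono (truncateTo M k) := by
  haveI := truncateTo_finite M k
  apply biIndepMono_of_normSkew
  have h' := normSkew_biIndepCount_of_mono M h
  intro i j hij hR
  rw [truncateTo_E] at hR ⊢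
  rw [biIndepCount_eq_minorPairCount_empty, biIndepCount_eq_minorPairCount_empty,
    minorPairCount_truncateTo M (Set.empty_subset _) k i, minorPairCount_truncateTo M (Set.empty_subset _) k j]
  simp only [Set.ncard_empty, Nat.add_zero]
  rw [← biIndepCount_eq_minorPairCount_empty, ← biIndepCount_eq_minorPairCount_empty]
  split_ifs with hi hj hj
  · exact h' i j hij hR
  · exfalso
    omega
  · rw [Nat.zero_mul]
    exact Nat.zero_le _
  · rw [Nat.zero_mul]
    exact Nat.zero_le _

end PercRepro
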